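import Literature.NumberTheory.LFunctions.KloostermanFractionsOffDiagDegenerate
import Literature.NumberTheory.LFunctions.KloostermanFractionsAmplifiedForm
import HarnessLib

/-!
# Bilinear forms with Kloosterman fractions: the terms with `(n₁, n₂) > 1` (B–C §4.2)

Bettin–Chandee, *Trilinear forms with Kloosterman fractions* (arXiv:1502.00769), §4.2:
"We write `μ = (n₁', n₂')`.  This implies `(μ, ℓ₁ℓ₂) = 1` and `n₁ = μh₁`, `n₂ = μh₂` … It
follows that `𝒮* = Σ_{1<μ≤N, (μ,ϑb)=1} 𝒮_{b,η}(M, N/μ, A, 𝓛, β_μ, ν)`, where `β_μ(n) := β_{μn}`."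

In the setting of `KloostermanFractionsAmplifiedForm` (amplifier `A = 1`), this file splits the
off-diagonal `Σ_m kfOff(m)` into the degenerate tuples (`ℓ₁ = ℓ₂` or `(n₁n₂, ℓ₁ℓ₂) > 1`,
bounded in `KloostermanFractionsOffDiagDegenerate`) and, grouping the remaining tuples by
`μ = (n₁, n₂)`, a sum over `μ` of coprime nondegenerate sums `𝒮(bμ, N'/μ, γ_μ, 𝓛_μ)` of the
shape treated in `KloostermanFractionsOffDiagCS` (`kfm_offdiag_split`); it also records the
trivial bound for one such sum (`kfm_S_triv`, used for large `μ`) and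
`Σ_μ ‖γ_μ‖² ≤ T ‖γ‖²` (`kfm_sum_norm_sq_mu`).

## References
* S. Bettin, V. Chandee, *Trilinear forms with Kloosterman fractions*, Adv. Math. 328 (2018),
  arXiv:1502.00769, §4.2. [cite: BettinChandee2018, §4.2]
* W. Duke, J. Friedlander, H. Iwaniec, *Bilinear forms with Kloosterman fractions*,
  Invent. Math. 128 (1997) 23–43, §4. [cite: DukeFriedlanderIwaniec1997, §4]
-/

noncomputable section

open Finset

namespace Literature.NumberTheory.LFunctions

/-! ### Grouping pairs by their gcd -/

/-- **Grouping pairs `(n₁, n₂)` by `μ = (n₁, n₂)`**: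
`Σ_{n₁,n₂ ≤ 2N} f(n₁,n₂) = Σ_{μ ≤ 2N} Σ_{h₁,h₂ ≤ 2N/μ, (h₁,h₂)=1} f(μh₁, μh₂)`. [folklore] -/
theorem kfm_sum_pairs_gcd {E : Type*} [AddCommMonoid E] (N : ℝ) (f : ℕ → ℕ → E) :
    ∑ n₁ ∈ Icc 1 ⌊2 * N⌋₊, ∑ n₂ ∈ Icc 1 ⌊2 * N⌋₊, f n₁ n₂ =
      ∑ μ ∈ Icc 1 ⌊2 * N⌋₊, ∑ h₁ ∈ Icc 1 ⌊2 * (N / μ)⌋₊, ∑ h₂ ∈ Icc 1 ⌊2 * (N / μ)⌋₊,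
        (if h₁.Coprime h₂ then f (μ * h₁) (μ * h₂) else 0) := by
  classical
  set I := Icc 1 ⌊2 * N⌋₊ with hI
  rw [← Finset.sum_product']
  rw [← Finset.sum_fiberwise_of_maps_to (g := fun p : ℕ × ℕ => Nat.gcd p.1 p.2) (t := I)
    (fun p hp => by
      have hp' := Finset.mem_product.mp hp
      have h1 := Finset.mem_Icc.mp hp'.1
      rw [hI, Finset.mem_Icc]
      exact ⟨Nat.gcd_pos_of_pos_left _ (by omega),
        (Nat.gcd_le_left _ (by omega)).trans h1.2⟩)]
  refine Finset.sum_congr rfl fun μ hμ => ?_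
  have hμ0 : 0 < μ := (Finset.mem_Icc.mp hμ).1
  have hfloor : ⌊2 * (N / μ)⌋₊ = ⌊2 * N⌋₊ / μ := by
    rw [show (2 : ℝ) * (N / μ) = 2 * N / μ by ring, Nat.floor_div_natCast]
  rw [← Finset.sum_product', ← Finset.sum_filter]
  symm
  refine Finset.sum_nbij' (fun q : ℕ × ℕ => (μ * q.1, μ * q.2))
    (fun p : ℕ × ℕ => (p.1 / μ, p.2 / μ)) ?_ ?_ ?_ ?_ ?_
  · intro q hq
    rw [Finset.mem_filter, Finset.mem_product, Finset.mem_Icc, Finset.mem_Icc, hfloor] at hq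
    obtain ⟨⟨⟨h11, h12⟩, ⟨h21, h22⟩⟩, hc⟩ := hq
    rw [Finset.mem_filter, Finset.mem_product, hI, Finset.mem_Icc, Finset.mem_Icc]
    refine ⟨⟨⟨?_, ?_⟩, ⟨?_, ?_⟩⟩, ?_⟩
    · have := Nat.mul_le_mul hμ0 h11; simpa using this
    · exact (Nat.mul_le_mul_left μ h12).trans (Nat.mul_div_le _ _)
    · have := Nat.mul_le_mul hμ0 h21; simpa using this
    · exact (Nat.mul_le_mul_left μ h22).trans (Nat.mul_div_le _ _)
    · show Nat.gcd (μ * q.1) (μ * q.2) = μ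
      rw [Nat.gcd_mul_left, Nat.Coprime.gcd_eq_one hc, mul_one]
  · intro p hp
    rw [Finset.mem_filter, Finset.mem_product, hI, Finset.mem_Icc, Finset.mem_Icc] at hp
    obtain ⟨⟨⟨h11, h12⟩, ⟨h21, h22⟩⟩, hg⟩ := hp
    have hd1 : μ ∣ p.1 := hg ▸ Nat.gcd_dvd_left p.1 p.2
    have hd2 : μ ∣ p.2 := hg ▸ Nat.gcd_dvd_right p.1 p.2
    rw [Finset.mem_filter, Finset.mem_product, Finset.mem_Icc, Finset.mem_Icc, hfloor]
    refine ⟨⟨⟨Nat.div_pos (Nat.le_of_dvd (by omega) hd1) hμ0, Nat.div_le_div_right h12⟩,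
      ⟨Nat.div_pos (Nat.le_of_dvd (by omega) hd2) hμ0, Nat.div_le_div_right h22⟩⟩, ?_⟩
    show Nat.gcd (p.1 / μ) (p.2 / μ) = 1
    rw [Nat.gcd_div hd1 hd2, hg, Nat.div_self hμ0]
  · intro q _
    simp only [Nat.mul_div_cancel_left _ hμ0]
  · intro p hp
    have hp' : p ∈ (I ×ˢ I).filter (fun i : ℕ × ℕ => Nat.gcd i.1 i.2 = μ) := by simpa using hp
    rw [Finset.mem_filter] at hp'
    have hd1 : μ ∣ p.1 := hp'.2 ▸ Nat.gcd_dvd_left p.1 p.2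
    have hd2 : μ ∣ p.2 := hp'.2 ▸ Nat.gcd_dvd_right p.1 p.2
    simp only [Nat.mul_div_cancel' hd1, Nat.mul_div_cancel' hd2]
  · intro q _
    rfl

/-- Nondegenerate tuples are off-diagonal: for primes `ℓ₁ ≠ ℓ₂` with `(n₁n₂, ℓ₁ℓ₂) = 1`,
`ℓ₁ n₁ ≠ ℓ₂ n₂`. [folklore] -/
theorem kfm_ne_of_nondeg {ℓ₁ ℓ₂ n₁ n₂ : ℕ} (hp₁ : ℓ₁.Prime) (hp₂ : ℓ₂.Prime)
    (h : ℓ₁ ≠ ℓ₂ ∧ (n₁ * n₂).Coprime (ℓ₁ * ℓ₂)) : ℓ₁ * n₁ ≠ ℓ₂ * n₂ := by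
  intro heq
  have h1 : ℓ₁ ∣ ℓ₂ * n₂ := ⟨n₁, heq.symm⟩
  rcases (Nat.Prime.dvd_mul hp₁).mp h1 with h2 | h2
  · exact h.1 ((Nat.prime_dvd_prime_iff_eq hp₁ hp₂).mp h2)
  · have h3 : ℓ₁ ∣ Nat.gcd (n₁ * n₂) (ℓ₁ * ℓ₂) :=
      Nat.dvd_gcd (dvd_mul_of_dvd_right h2 _) (dvd_mul_right _ _)
    rw [h.2] at h3
    exact hp₁.one_lt.ne' (Nat.dvd_one.mp h3)

/-! ### Rescaling one term -/

/-- **Rescaling by `μ`**: for `(m, μ) = 1`, the term of `Σ_m` at `(ℓ₁, μh₁, ℓ₂, μh₂)` is the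
term at `(ℓ₁, h₁, ℓ₂, h₂)` with `b` replaced by `bμ` and `γ` by `γ_μ = γ(μ ·)`; for
`(m, μ) > 1` it vanishes ("`e(a₁ m̄/(bμh₁) - a₂ m̄/(bμh₂))`", B–C §4.2).
[cite: BettinChandee2018, §4.2] -/
theorem kfm_term_rescale (k : ℤ) (b : ℕ) (γ : ℕ → ℂ) (m μ ℓ₁ h₁ ℓ₂ h₂ : ℕ) :
    kfTerm k b γ m ℓ₁ (μ * h₁) ℓ₂ (μ * h₂) =
      if m.Coprime μ then
        (if (ℓ₂ * h₂).Coprime m ∧ ((ℓ₁ * h₁ : ℕ) : ZMod m) = ((ℓ₂ * h₂ : ℕ) : ZMod m) then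
          γ (μ * h₁) * kfPhase k (b * μ * h₁) m *
            (starRingEnd ℂ) (γ (μ * h₂) * kfPhase k (b * μ * h₂) m) else 0)
      else 0 := by
  unfold kfTerm kfCoeff
  have hassoc : ∀ h, b * (μ * h) = b * μ * h := fun h => (Nat.mul_assoc b μ h).symm
  by_cases hc : m.Coprime μ
  · rw [if_pos hc]
    have hunit : IsUnit ((μ : ℕ) : ZMod m) := (ZMod.isUnit_iff_coprime μ m).mpr hc.symm
    have hcond : ((ℓ₂ * (μ * h₂)).Coprime m ∧
        ((ℓ₁ * (μ * h₁) : ℕ) : ZMod m) = ((ℓ₂ * (μ * h₂) : ℕ) : ZMod m)) ↔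
        ((ℓ₂ * h₂).Coprime m ∧ ((ℓ₁ * h₁ : ℕ) : ZMod m) = ((ℓ₂ * h₂ : ℕ) : ZMod m)) := by
      have e1 : ℓ₂ * (μ * h₂) = μ * (ℓ₂ * h₂) := by ring
      have e2 : ℓ₁ * (μ * h₁) = μ * (ℓ₁ * h₁) := by ring
      rw [e1, e2]
      constructor
      · rintro ⟨h1, h2⟩
        refine ⟨Nat.Coprime.coprime_mul_left h1, ?_⟩
        rw [Nat.cast_mul, Nat.cast_mul μ] at h2
        exact hunit.mul_left_cancel h2
      · rintro ⟨h1, h2⟩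
        refine ⟨Nat.Coprime.mul_left hc.symm h1, ?_⟩
        rw [Nat.cast_mul, Nat.cast_mul μ, h2]
    by_cases h1 : (ℓ₂ * h₂).Coprime m ∧ ((ℓ₁ * h₁ : ℕ) : ZMod m) = ((ℓ₂ * h₂ : ℕ) : ZMod m)
    · rw [if_pos h1, if_pos (hcond.mpr h1), hassoc, hassoc]
    · rw [if_neg h1, if_neg (fun h => h1 (hcond.mp h))]
  · rw [if_neg hc, if_neg]
    rintro ⟨h1, _⟩
    apply hc
    have e1 : ℓ₂ * (μ * h₂) = μ * (ℓ₂ * h₂) := by ring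
    rw [e1] at h1
    exact (Nat.Coprime.coprime_mul_right h1).symm

/-- Pointwise split of an off-diagonal term into its degenerate and nondegenerate parts
(nondegenerate tuples are automatically off-diagonal, `kfm_ne_of_nondeg`). [folklore] -/
theorem kfm_term_split (k : ℤ) (b : ℕ) (γ : ℕ → ℂ) (m : ℕ) {ℓ₁ ℓ₂ : ℕ} (hp₁ : ℓ₁.Prime)
    (hp₂ : ℓ₂.Prime) (n₁ n₂ : ℕ) :
    (if ℓ₁ * n₁ = ℓ₂ * n₂ then 0 else kfTerm k b γ m ℓ₁ n₁ ℓ₂ n₂) =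
      (if ℓ₁ * n₁ = ℓ₂ * n₂ then 0 else
        if (ℓ₁ = ℓ₂ ∨ ¬ (n₁ * n₂).Coprime (ℓ₁ * ℓ₂)) then kfTerm k b γ m ℓ₁ n₁ ℓ₂ n₂ else 0) +
      (if (ℓ₁ ≠ ℓ₂ ∧ (n₁ * n₂).Coprime (ℓ₁ * ℓ₂)) then kfTerm k b γ m ℓ₁ n₁ ℓ₂ n₂ else 0) := by
  by_cases hnd : ℓ₁ ≠ ℓ₂ ∧ (n₁ * n₂).Coprime (ℓ₁ * ℓ₂)
  · have hne := kfm_ne_of_nondeg hp₁ hp₂ hnd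
    have h2 : ¬ (ℓ₁ = ℓ₂ ∨ ¬ (n₁ * n₂).Coprime (ℓ₁ * ℓ₂)) := by tauto
    rw [if_neg hne, if_neg hne, if_pos hnd, if_neg h2, zero_add]
  · rw [if_neg hnd, add_zero]
    by_cases heq : ℓ₁ * n₁ = ℓ₂ * n₂
    · rw [if_pos heq, if_pos heq]
    · have h2 : (ℓ₁ = ℓ₂ ∨ ¬ (n₁ * n₂).Coprime (ℓ₁ * ℓ₂)) := by tauto
      rw [if_neg heq, if_neg heq, if_pos h2]

/-! ### The split of the off-diagonal -/

set_option maxHeartbeats 800000 in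
/-- **The off-diagonal split by degeneracy and by `μ = (n₁, n₂)`** (B–C §4.2 with `A = 1`):
`Σ_{M₁<m≤M₂,(m,b)=1} kfOff(m) = (degenerate tuples) + Σ_{μ ≤ 2N'} 𝒮(bμ, N'/μ, γ_μ, 𝓛_μ)`,
where `γ_μ = γ(μ ·)`, `𝓛_μ = {ℓ ∈ 𝓛 : (ℓ, μ) = 1}` and `𝒮` is the coprime nondegenerate sum of
`KloostermanFractionsOffDiagCS` (with the `m`-range `(M₁, M₂] ∩ {(m, bμ) = 1}`).
[cite: BettinChandee2018, §4.2] -/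
theorem kfm_offdiag_split (k : ℤ) (b : ℕ) (N' : ℝ) (γ : ℕ → ℂ) (𝓛 : Finset ℕ)
    (h𝓛 : ∀ ℓ ∈ 𝓛, ℓ.Prime) (M₁ M₂ : ℕ) :
    ∑ m ∈ (Ioc M₁ M₂).filter (fun m => m.Coprime b), kfOff k b N' γ 𝓛 m =
      ∑ m ∈ (Ioc M₁ M₂).filter (fun m => m.Coprime b),
        ∑ ℓ₁ ∈ 𝓛, ∑ n₁ ∈ Icc 1 ⌊2 * N'⌋₊, ∑ ℓ₂ ∈ 𝓛, ∑ n₂ ∈ Icc 1 ⌊2 * N'⌋₊,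
          (if ℓ₁ * n₁ = ℓ₂ * n₂ then 0 else
            if (ℓ₁ = ℓ₂ ∨ ¬ (n₁ * n₂).Coprime (ℓ₁ * ℓ₂)) then
              (if (ℓ₂ * n₂).Coprime m ∧ ((ℓ₁ * n₁ : ℕ) : ZMod m) = ((ℓ₂ * n₂ : ℕ) : ZMod m) then
                γ n₁ * kfPhase k (b * n₁) m * (starRingEnd ℂ) (γ n₂ * kfPhase k (b * n₂) m)
              else 0)
            else 0) +
      ∑ μ ∈ Icc 1 ⌊2 * N'⌋₊, ∑ m ∈ (Ioc M₁ M₂).filter (fun m => m.Coprime (b * μ)),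
        ∑ ℓ₁ ∈ 𝓛.filter (fun ℓ => ℓ.Coprime μ), ∑ h₁ ∈ Icc 1 ⌊2 * (N' / μ)⌋₊,
        ∑ ℓ₂ ∈ 𝓛.filter (fun ℓ => ℓ.Coprime μ), ∑ h₂ ∈ Icc 1 ⌊2 * (N' / μ)⌋₊,
          (if (ℓ₁ ≠ ℓ₂ ∧ h₁.Coprime h₂ ∧ (h₁ * h₂).Coprime (ℓ₁ * ℓ₂)) then
            (if (ℓ₂ * h₂).Coprime m ∧ ((ℓ₁ * h₁ : ℕ) : ZMod m) = ((ℓ₂ * h₂ : ℕ) : ZMod m) then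
              γ (μ * h₁) * kfPhase k (b * μ * h₁) m *
                (starRingEnd ℂ) (γ (μ * h₂) * kfPhase k (b * μ * h₂) m) else 0)
          else 0) := by
  classical
  set I := Icc 1 ⌊2 * N'⌋₊ with hI
  set 𝓜 := (Ioc M₁ M₂).filter (fun m => m.Coprime b) with h𝓜
  set DG : ℕ → ℕ → ℕ → ℕ → ℕ → ℂ := fun m ℓ₁ n₁ ℓ₂ n₂ =>
    (if ℓ₁ * n₁ = ℓ₂ * n₂ then 0 else
      if (ℓ₁ = ℓ₂ ∨ ¬ (n₁ * n₂).Coprime (ℓ₁ * ℓ₂)) then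
        (if (ℓ₂ * n₂).Coprime m ∧ ((ℓ₁ * n₁ : ℕ) : ZMod m) = ((ℓ₂ * n₂ : ℕ) : ZMod m) then
          γ n₁ * kfPhase k (b * n₁) m * (starRingEnd ℂ) (γ n₂ * kfPhase k (b * n₂) m)
        else 0)
      else 0) with hDG
  set ND : ℕ → ℕ → ℕ → ℕ → ℕ → ℂ := fun m ℓ₁ n₁ ℓ₂ n₂ =>
    if (ℓ₁ ≠ ℓ₂ ∧ (n₁ * n₂).Coprime (ℓ₁ * ℓ₂)) then kfTerm k b γ m ℓ₁ n₁ ℓ₂ n₂ else 0 with hND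
  set RT : ℕ → ℕ → ℕ → ℕ → ℕ → ℕ → ℂ := fun μ m ℓ₁ h₁ ℓ₂ h₂ =>
    (if (ℓ₁ ≠ ℓ₂ ∧ h₁.Coprime h₂ ∧ (h₁ * h₂).Coprime (ℓ₁ * ℓ₂)) then
      (if (ℓ₂ * h₂).Coprime m ∧ ((ℓ₁ * h₁ : ℕ) : ZMod m) = ((ℓ₂ * h₂ : ℕ) : ZMod m) then
        γ (μ * h₁) * kfPhase k (b * μ * h₁) m *
          (starRingEnd ℂ) (γ (μ * h₂) * kfPhase k (b * μ * h₂) m) else 0)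
      else 0) with hRT
  -- Step 1: split each `kfOff m`
  have hT : ∀ m ℓ₁ n₁ ℓ₂ n₂, kfTerm k b γ m ℓ₁ n₁ ℓ₂ n₂ =
      (if (ℓ₂ * n₂).Coprime m ∧ ((ℓ₁ * n₁ : ℕ) : ZMod m) = ((ℓ₂ * n₂ : ℕ) : ZMod m) then
        γ n₁ * kfPhase k (b * n₁) m * (starRingEnd ℂ) (γ n₂ * kfPhase k (b * n₂) m) else 0) :=
    fun _ _ _ _ _ => rfl
  have h1 : ∀ m, kfOff k b N' γ 𝓛 m = (∑ ℓ₁ ∈ 𝓛, ∑ n₁ ∈ I, ∑ ℓ₂ ∈ 𝓛, ∑ n₂ ∈ I,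
      DG m ℓ₁ n₁ ℓ₂ n₂) + ∑ ℓ₁ ∈ 𝓛, ∑ n₁ ∈ I, ∑ ℓ₂ ∈ 𝓛, ∑ n₂ ∈ I, ND m ℓ₁ n₁ ℓ₂ n₂ := by
    intro m
    unfold kfOff
    rw [← Finset.sum_add_distrib]
    refine Finset.sum_congr rfl fun ℓ₁ hℓ₁ => ?_
    rw [← Finset.sum_add_distrib]
    refine Finset.sum_congr rfl fun n₁ _ => ?_
    rw [← Finset.sum_add_distrib]
    refine Finset.sum_congr rfl fun ℓ₂ hℓ₂ => ?_
    rw [← Finset.sum_add_distrib]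
    refine Finset.sum_congr rfl fun n₂ _ => ?_
    rw [kfm_term_split k b γ m (h𝓛 ℓ₁ hℓ₁) (h𝓛 ℓ₂ hℓ₂) n₁ n₂]
    rfl
  -- Step 2: pointwise rescaling of the nondegenerate part
  have h2 : ∀ (m μ ℓ₁ h₁ ℓ₂ h₂ : ℕ),
      (if h₁.Coprime h₂ then ND m ℓ₁ (μ * h₁) ℓ₂ (μ * h₂) else 0) =
      (if ((ℓ₁.Coprime μ ∧ ℓ₂.Coprime μ) ∧ m.Coprime μ) then RT μ m ℓ₁ h₁ ℓ₂ h₂ else 0) := by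
    intro m μ ℓ₁ h₁ ℓ₂ h₂
    simp only [hND, hRT]
    have hcop : (μ * h₁ * (μ * h₂)).Coprime (ℓ₁ * ℓ₂) ↔
        ((ℓ₁.Coprime μ ∧ ℓ₂.Coprime μ) ∧ (h₁ * h₂).Coprime (ℓ₁ * ℓ₂)) := by
      have e1 : μ * h₁ * (μ * h₂) = (μ * μ) * (h₁ * h₂) := by ring
      rw [e1, Nat.coprime_mul_iff_left, Nat.coprime_mul_iff_left, and_self,
        Nat.coprime_mul_iff_right, Nat.coprime_comm (m := μ) (n := ℓ₁),
        Nat.coprime_comm (m := μ) (n := ℓ₂)]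
    have hND' : (ℓ₁ ≠ ℓ₂ ∧ (μ * h₁ * (μ * h₂)).Coprime (ℓ₁ * ℓ₂)) ↔
        ((ℓ₁.Coprime μ ∧ ℓ₂.Coprime μ) ∧ (ℓ₁ ≠ ℓ₂ ∧ (h₁ * h₂).Coprime (ℓ₁ * ℓ₂))) := by
      rw [hcop]; tauto
    rw [kfm_term_rescale, if_congr hND' rfl rfl]
    split_ifs <;> first | rfl | (exfalso; tauto)
  -- Step 3: for fixed `m`, regroup the nondegenerate part by `μ`
  have h3 : ∀ (m : ℕ), ∑ ℓ₁ ∈ 𝓛, ∑ n₁ ∈ I, ∑ ℓ₂ ∈ 𝓛, ∑ n₂ ∈ I, ND m ℓ₁ n₁ ℓ₂ n₂ =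
      ∑ μ ∈ I, ∑ ℓ₁ ∈ 𝓛, ∑ ℓ₂ ∈ 𝓛, ∑ h₁ ∈ Icc 1 ⌊2 * (N' / μ)⌋₊,
        ∑ h₂ ∈ Icc 1 ⌊2 * (N' / μ)⌋₊,
        (if ((ℓ₁.Coprime μ ∧ ℓ₂.Coprime μ) ∧ m.Coprime μ) then RT μ m ℓ₁ h₁ ℓ₂ h₂ else 0) := by
    intro m
    calc ∑ ℓ₁ ∈ 𝓛, ∑ n₁ ∈ I, ∑ ℓ₂ ∈ 𝓛, ∑ n₂ ∈ I, ND m ℓ₁ n₁ ℓ₂ n₂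
        = ∑ ℓ₁ ∈ 𝓛, ∑ ℓ₂ ∈ 𝓛, ∑ n₁ ∈ I, ∑ n₂ ∈ I, ND m ℓ₁ n₁ ℓ₂ n₂ :=
          Finset.sum_congr rfl fun ℓ₁ _ => Finset.sum_comm
      _ = ∑ ℓ₁ ∈ 𝓛, ∑ ℓ₂ ∈ 𝓛, ∑ μ ∈ I, ∑ h₁ ∈ Icc 1 ⌊2 * (N' / μ)⌋₊,
            ∑ h₂ ∈ Icc 1 ⌊2 * (N' / μ)⌋₊,
            (if ((ℓ₁.Coprime μ ∧ ℓ₂.Coprime μ) ∧ m.Coprime μ) then RT μ m ℓ₁ h₁ ℓ₂ h₂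
              else 0) := by
          refine Finset.sum_congr rfl fun ℓ₁ _ => Finset.sum_congr rfl fun ℓ₂ _ => ?_
          rw [hI, kfm_sum_pairs_gcd N' (fun n₁ n₂ => ND m ℓ₁ n₁ ℓ₂ n₂)]
          refine Finset.sum_congr rfl fun μ _ => Finset.sum_congr rfl fun h₁ _ =>
            Finset.sum_congr rfl fun h₂ _ => ?_
          exact h2 m μ ℓ₁ h₁ ℓ₂ h₂
      _ = ∑ ℓ₁ ∈ 𝓛, ∑ μ ∈ I, ∑ ℓ₂ ∈ 𝓛, ∑ h₁ ∈ Icc 1 ⌊2 * (N' / μ)⌋₊,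
            ∑ h₂ ∈ Icc 1 ⌊2 * (N' / μ)⌋₊,
            (if ((ℓ₁.Coprime μ ∧ ℓ₂.Coprime μ) ∧ m.Coprime μ) then RT μ m ℓ₁ h₁ ℓ₂ h₂
              else 0) := Finset.sum_congr rfl fun ℓ₁ _ => Finset.sum_comm
      _ = _ := Finset.sum_comm
  -- Step 4: indicators to filters
  have h4 : ∀ (m μ : ℕ), ∑ ℓ₁ ∈ 𝓛, ∑ ℓ₂ ∈ 𝓛, ∑ h₁ ∈ Icc 1 ⌊2 * (N' / μ)⌋₊,
      ∑ h₂ ∈ Icc 1 ⌊2 * (N' / μ)⌋₊,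
      (if ((ℓ₁.Coprime μ ∧ ℓ₂.Coprime μ) ∧ m.Coprime μ) then RT μ m ℓ₁ h₁ ℓ₂ h₂ else 0) =
      if m.Coprime μ then ∑ ℓ₁ ∈ 𝓛.filter (fun ℓ => ℓ.Coprime μ),
        ∑ h₁ ∈ Icc 1 ⌊2 * (N' / μ)⌋₊, ∑ ℓ₂ ∈ 𝓛.filter (fun ℓ => ℓ.Coprime μ),
        ∑ h₂ ∈ Icc 1 ⌊2 * (N' / μ)⌋₊, RT μ m ℓ₁ h₁ ℓ₂ h₂ else 0 := by
    intro m μ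
    by_cases hm : m.Coprime μ
    · rw [if_pos hm, Finset.sum_filter]
      refine Finset.sum_congr rfl fun ℓ₁ _ => ?_
      by_cases hl₁ : ℓ₁.Coprime μ
      · rw [if_pos hl₁, Finset.sum_comm]
        refine Finset.sum_congr rfl fun h₁ _ => ?_
        rw [Finset.sum_filter]
        refine Finset.sum_congr rfl fun ℓ₂ _ => ?_
        by_cases hl₂ : ℓ₂.Coprime μ
        · rw [if_pos hl₂]
          refine Finset.sum_congr rfl fun h₂ _ => ?_
          rw [if_pos ⟨⟨hl₁, hl₂⟩, hm⟩]
        · rw [if_neg hl₂]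
          refine Finset.sum_eq_zero fun h₂ _ => ?_
          rw [if_neg (fun h => hl₂ h.1.2)]
      · rw [if_neg hl₁]
        refine Finset.sum_eq_zero fun ℓ₂ _ => Finset.sum_eq_zero fun h₁ _ =>
          Finset.sum_eq_zero fun h₂ _ => ?_
        rw [if_neg (fun h => hl₁ h.1.1)]
    · rw [if_neg hm]
      refine Finset.sum_eq_zero fun ℓ₁ _ => Finset.sum_eq_zero fun ℓ₂ _ =>
        Finset.sum_eq_zero fun h₁ _ => Finset.sum_eq_zero fun h₂ _ => ?_
      rw [if_neg (fun h => hm h.2)]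
  have h5 : ∀ (μ : ℕ), 𝓜.filter (fun m => m.Coprime μ) =
      (Ioc M₁ M₂).filter (fun m => m.Coprime (b * μ)) := by
    intro μ
    rw [h𝓜, Finset.filter_filter]
    refine Finset.filter_congr fun m _ => ?_
    rw [Nat.coprime_mul_iff_right]
  -- assemble
  rw [Finset.sum_congr rfl fun m _ => h1 m, Finset.sum_add_distrib]
  congr 1
  rw [Finset.sum_congr rfl fun m _ => h3 m, Finset.sum_comm]
  refine Finset.sum_congr rfl fun μ _ => ?_
  rw [Finset.sum_congr rfl fun m _ => h4 m μ, ← Finset.sum_filter, h5 μ]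

/-! ### The trivial bound for one coprime sum, and `Σ_μ ‖γ_μ‖²` -/

set_option maxHeartbeats 400000 in
/-- **Trivial bound for a coprime nondegenerate sum** (used for large `μ`): bounding each term
by `|γ_{n₁}γ_{n₂}|` and the number of `m ∣ ℓ₁n₁ - ℓ₂n₂ ≠ 0` by `τ ≤ T'`,
`‖𝒮‖ ≤ T' · #𝓛² · 2N' · ‖γ‖²`. [cite: BettinChandee2018, §4.2] -/
theorem kfm_S_triv (k : ℤ) (b : ℕ) {L : ℕ} (𝓛 : Finset ℕ)
    (h𝓛 : ∀ ℓ ∈ 𝓛, ℓ.Prime ∧ L < ℓ ∧ ℓ ≤ 2 * L) {N' : ℝ} (hN' : 0 ≤ N') (γ : ℕ → ℂ) {T' : ℝ}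
    (hT'0 : 0 ≤ T')
    (hT' : ∀ w : ℕ, 1 ≤ w → (w : ℝ) ≤ 4 * L * N' → (w.divisors.card : ℝ) ≤ T')
    (S : Finset ℕ) :
    ‖∑ m ∈ S, ∑ ℓ₁ ∈ 𝓛, ∑ n₁ ∈ Icc 1 ⌊2 * N'⌋₊, ∑ ℓ₂ ∈ 𝓛, ∑ n₂ ∈ Icc 1 ⌊2 * N'⌋₊,
        (if (ℓ₁ ≠ ℓ₂ ∧ n₁.Coprime n₂ ∧ (n₁ * n₂).Coprime (ℓ₁ * ℓ₂)) then
          (if (ℓ₂ * n₂).Coprime m ∧ ((ℓ₁ * n₁ : ℕ) : ZMod m) = ((ℓ₂ * n₂ : ℕ) : ZMod m) then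
            γ n₁ * kfPhase k (b * n₁) m * (starRingEnd ℂ) (γ n₂ * kfPhase k (b * n₂) m) else 0)
        else 0)‖ ≤
      T' * (𝓛.card : ℝ) ^ 2 * ((2 * N') * ∑ n ∈ Icc 1 ⌊2 * N'⌋₊, ‖γ n‖ ^ 2) := by
  set I := Icc 1 ⌊2 * N'⌋₊ with hI
  set g : ℕ → ℝ := fun n => ‖γ n‖ with hg
  set A : ℝ := ∑ n ∈ I, g n with hA
  have hg0 : ∀ n, 0 ≤ g n := fun n => norm_nonneg _
  have hA0 : 0 ≤ A := Finset.sum_nonneg fun n _ => hg0 n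
  have he : ∀ (k : ℤ) (q m : ℕ), kfPhase k q m = Complex.exp (2 * Real.pi * Complex.I *
      ((k : ℂ) * ((((m : ZMod q)⁻¹).val : ℕ) : ℂ) / (q : ℂ))) := fun _ _ _ => rfl
  -- `T' ≥ 0` unless the sum is empty
  -- per tuple
  have htuple : ∀ ℓ₁ ∈ 𝓛, ∀ n₁ ∈ I, ∀ ℓ₂ ∈ 𝓛, ∀ n₂ ∈ I,
      ∑ m ∈ S, ‖(if (ℓ₁ ≠ ℓ₂ ∧ n₁.Coprime n₂ ∧ (n₁ * n₂).Coprime (ℓ₁ * ℓ₂)) then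
          (if (ℓ₂ * n₂).Coprime m ∧ ((ℓ₁ * n₁ : ℕ) : ZMod m) = ((ℓ₂ * n₂ : ℕ) : ZMod m) then
            γ n₁ * kfPhase k (b * n₁) m * (starRingEnd ℂ) (γ n₂ * kfPhase k (b * n₂) m) else 0)
        else 0)‖ ≤ T' * (g n₁ * g n₂) := by
    intro ℓ₁ hℓ₁ n₁ hn₁ ℓ₂ hℓ₂ n₂ hn₂
    obtain ⟨hp₁, _, hℓ₁L⟩ := h𝓛 ℓ₁ hℓ₁
    obtain ⟨hp₂, _, hℓ₂L⟩ := h𝓛 ℓ₂ hℓ₂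
    have hn₁I := Finset.mem_Icc.mp hn₁
    have hn₂I := Finset.mem_Icc.mp hn₂
    by_cases hnd : ℓ₁ ≠ ℓ₂ ∧ n₁.Coprime n₂ ∧ (n₁ * n₂).Coprime (ℓ₁ * ℓ₂)
    · simp only [if_pos hnd]
      have hne := kfm_ne_of_nondeg hp₁ hp₂ ⟨hnd.1, hnd.2.2⟩
      have h1 := kfo_sum_m_norm_le kfPhase he k b γ S hne
      refine h1.trans (mul_le_mul_of_nonneg_right ?_ (mul_nonneg (hg0 _) (hg0 _)))
      -- `τ(|w|) ≤ T'`
      set w := Int.natAbs ((ℓ₁ * n₁ : ℤ) - ℓ₂ * n₂) with hw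
      have hw0 : w ≠ 0 := by
        intro h
        rw [hw, Int.natAbs_eq_zero, sub_eq_zero] at h
        exact hne (by exact_mod_cast h)
      refine hT' w (Nat.pos_of_ne_zero hw0) ?_
      have h2N : (⌊2 * N'⌋₊ : ℝ) ≤ 2 * N' := Nat.floor_le (by linarith)
      have hb1 : ((ℓ₁ * n₁ : ℕ) : ℝ) ≤ 2 * L * (2 * N') := by
        push_cast
        exact mul_le_mul (by exact_mod_cast hℓ₁L) ((Nat.cast_le.mpr hn₁I.2).trans h2N)
          (Nat.cast_nonneg _) (by positivity)
      have hb2 : ((ℓ₂ * n₂ : ℕ) : ℝ) ≤ 2 * L * (2 * N') := by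
        push_cast
        exact mul_le_mul (by exact_mod_cast hℓ₂L) ((Nat.cast_le.mpr hn₂I.2).trans h2N)
          (Nat.cast_nonneg _) (by positivity)
      have hwle : w ≤ max (ℓ₁ * n₁) (ℓ₂ * n₂) := by
        rw [hw]; omega
      calc (w : ℝ) ≤ ((max (ℓ₁ * n₁) (ℓ₂ * n₂) : ℕ) : ℝ) := by exact_mod_cast hwle
        _ ≤ 2 * L * (2 * N') := by
            rcases le_total (ℓ₁ * n₁) (ℓ₂ * n₂) with h | h
            · rw [max_eq_right h]; exact hb2
            · rw [max_eq_left h]; exact hb1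
        _ = 4 * L * N' := by ring
    · simp only [if_neg hnd, norm_zero, Finset.sum_const_zero]
      exact mul_nonneg hT'0 (mul_nonneg (hg0 _) (hg0 _))
  -- Cauchy–Schwarz for `A²`
  have hA2 : A * A ≤ (2 * N') * ∑ n ∈ I, ‖γ n‖ ^ 2 := by
    have h1 : (∑ n ∈ I, g n) ^ 2 ≤ I.card * ∑ n ∈ I, g n ^ 2 := sq_sum_le_card_mul_sum_sq
    have h2 : (I.card : ℝ) ≤ 2 * N' := by
      rw [hI, Nat.card_Icc]
      have : ((⌊2 * N'⌋₊ + 1 - 1 : ℕ) : ℝ) = ⌊2 * N'⌋₊ := by simp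
      rw [this]
      exact Nat.floor_le (by linarith)
    have h3 : 0 ≤ ∑ n ∈ I, g n ^ 2 := Finset.sum_nonneg fun n _ => by positivity
    calc A * A = (∑ n ∈ I, g n) ^ 2 := by rw [hA, sq]
      _ ≤ I.card * ∑ n ∈ I, g n ^ 2 := h1
      _ ≤ (2 * N') * ∑ n ∈ I, g n ^ 2 := mul_le_mul_of_nonneg_right h2 h3
      _ = (2 * N') * ∑ n ∈ I, ‖γ n‖ ^ 2 := by simp only [hg]
  -- sum up
  calc _ ≤ ∑ m ∈ S, ‖∑ ℓ₁ ∈ 𝓛, ∑ n₁ ∈ I, ∑ ℓ₂ ∈ 𝓛, ∑ n₂ ∈ I,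
          (if (ℓ₁ ≠ ℓ₂ ∧ n₁.Coprime n₂ ∧ (n₁ * n₂).Coprime (ℓ₁ * ℓ₂)) then
            (if (ℓ₂ * n₂).Coprime m ∧ ((ℓ₁ * n₁ : ℕ) : ZMod m) = ((ℓ₂ * n₂ : ℕ) : ZMod m) then
              γ n₁ * kfPhase k (b * n₁) m * (starRingEnd ℂ) (γ n₂ * kfPhase k (b * n₂) m)
              else 0)
          else 0)‖ := norm_sum_le _ _
    _ ≤ ∑ m ∈ S, ∑ ℓ₁ ∈ 𝓛, ∑ n₁ ∈ I, ∑ ℓ₂ ∈ 𝓛, ∑ n₂ ∈ I,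
          ‖(if (ℓ₁ ≠ ℓ₂ ∧ n₁.Coprime n₂ ∧ (n₁ * n₂).Coprime (ℓ₁ * ℓ₂)) then
            (if (ℓ₂ * n₂).Coprime m ∧ ((ℓ₁ * n₁ : ℕ) : ZMod m) = ((ℓ₂ * n₂ : ℕ) : ZMod m) then
              γ n₁ * kfPhase k (b * n₁) m * (starRingEnd ℂ) (γ n₂ * kfPhase k (b * n₂) m)
              else 0)
          else 0)‖ := by
        refine Finset.sum_le_sum fun m _ => ?_
        refine (norm_sum_le _ _).trans (Finset.sum_le_sum fun ℓ₁ _ => ?_)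
        refine (norm_sum_le _ _).trans (Finset.sum_le_sum fun n₁ _ => ?_)
        refine (norm_sum_le _ _).trans (Finset.sum_le_sum fun ℓ₂ _ => ?_)
        exact norm_sum_le _ _
    _ = ∑ ℓ₁ ∈ 𝓛, ∑ n₁ ∈ I, ∑ ℓ₂ ∈ 𝓛, ∑ n₂ ∈ I, ∑ m ∈ S,
          ‖(if (ℓ₁ ≠ ℓ₂ ∧ n₁.Coprime n₂ ∧ (n₁ * n₂).Coprime (ℓ₁ * ℓ₂)) then
            (if (ℓ₂ * n₂).Coprime m ∧ ((ℓ₁ * n₁ : ℕ) : ZMod m) = ((ℓ₂ * n₂ : ℕ) : ZMod m) then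
              γ n₁ * kfPhase k (b * n₁) m * (starRingEnd ℂ) (γ n₂ * kfPhase k (b * n₂) m)
              else 0)
          else 0)‖ := by
        rw [Finset.sum_comm]
        refine Finset.sum_congr rfl fun ℓ₁ _ => ?_
        rw [Finset.sum_comm]
        refine Finset.sum_congr rfl fun n₁ _ => ?_
        rw [Finset.sum_comm]
        refine Finset.sum_congr rfl fun ℓ₂ _ => ?_
        rw [Finset.sum_comm]
    _ ≤ ∑ ℓ₁ ∈ 𝓛, ∑ n₁ ∈ I, ∑ ℓ₂ ∈ 𝓛, ∑ n₂ ∈ I, T' * (g n₁ * g n₂) :=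
        Finset.sum_le_sum fun ℓ₁ hℓ₁ => Finset.sum_le_sum fun n₁ hn₁ =>
          Finset.sum_le_sum fun ℓ₂ hℓ₂ => Finset.sum_le_sum fun n₂ hn₂ =>
            htuple ℓ₁ hℓ₁ n₁ hn₁ ℓ₂ hℓ₂ n₂ hn₂
    _ = T' * (𝓛.card : ℝ) ^ 2 * (A * A) := by
        have h1 : ∀ ℓ₁ ∈ 𝓛, ∀ n₁ ∈ I, ∑ ℓ₂ ∈ 𝓛, ∑ n₂ ∈ I, T' * (g n₁ * g n₂) =
            (𝓛.card : ℝ) * (T' * g n₁ * A) := by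
          intro ℓ₁ _ n₁ _
          rw [Finset.sum_const, nsmul_eq_mul, hA, Finset.mul_sum, Finset.mul_sum, Finset.mul_sum]
          exact Finset.sum_congr rfl fun n₂ _ => by ring
        rw [Finset.sum_congr rfl fun ℓ₁ hℓ₁ => Finset.sum_congr rfl fun n₁ hn₁ =>
          h1 ℓ₁ hℓ₁ n₁ hn₁]
        rw [Finset.sum_const, nsmul_eq_mul]
        rw [show ∑ n₁ ∈ I, (𝓛.card : ℝ) * (T' * g n₁ * A) =
          (𝓛.card : ℝ) * T' * A * ∑ n₁ ∈ I, g n₁ by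
            rw [Finset.mul_sum]; exact Finset.sum_congr rfl fun n₁ _ => by ring]
        rw [← hA]
        ring
    _ ≤ T' * (𝓛.card : ℝ) ^ 2 * ((2 * N') * ∑ n ∈ I, ‖γ n‖ ^ 2) :=
        mul_le_mul_of_nonneg_left hA2 (by positivity)

/-- **`Σ_μ ‖γ_μ‖² ≤ T ‖γ‖²`** (`γ_μ = γ(μ·)` on `h ≤ 2N'/μ`; each `n` occurs once for every
divisor `μ ∣ n`, and `τ(n) ≤ T` on the support of `γ`). [cite: BettinChandee2018, §4.2] -/
theorem kfm_sum_norm_sq_mu (N' : ℝ) (γ : ℕ → ℂ) {T : ℝ}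
    (hT : ∀ n, γ n ≠ 0 → (n.divisors.card : ℝ) ≤ T) :
    ∑ μ ∈ Icc 1 ⌊2 * N'⌋₊, ∑ h ∈ Icc 1 ⌊2 * (N' / μ)⌋₊, ‖γ (μ * h)‖ ^ 2 ≤
      T * ∑ n ∈ Icc 1 ⌊2 * N'⌋₊, ‖γ n‖ ^ 2 := by
  classical
  set I := Icc 1 ⌊2 * N'⌋₊ with hI
  -- reindex `h ↦ n = μ h`
  have h1 : ∀ μ ∈ I, ∑ h ∈ Icc 1 ⌊2 * (N' / μ)⌋₊, ‖γ (μ * h)‖ ^ 2 =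
      ∑ n ∈ I.filter (fun n => μ ∣ n), ‖γ n‖ ^ 2 := by
    intro μ hμ
    have hμ0 : 0 < μ := (Finset.mem_Icc.mp hμ).1
    have hfloor : ⌊2 * (N' / μ)⌋₊ = ⌊2 * N'⌋₊ / μ := by
      rw [show (2 : ℝ) * (N' / μ) = 2 * N' / μ by ring, Nat.floor_div_natCast]
    refine Finset.sum_nbij' (fun h => μ * h) (fun n => n / μ) ?_ ?_ ?_ ?_ ?_
    · intro h hh
      rw [Finset.mem_Icc, hfloor] at hh
      rw [Finset.mem_filter, hI, Finset.mem_Icc]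
      refine ⟨⟨?_, ?_⟩, dvd_mul_right _ _⟩
      · have := Nat.mul_le_mul hμ0 hh.1; simpa using this
      · exact (Nat.mul_le_mul_left μ hh.2).trans (Nat.mul_div_le _ _)
    · intro n hn
      rw [Finset.mem_filter, hI, Finset.mem_Icc] at hn
      obtain ⟨⟨hn1, hn2⟩, hdvd⟩ := hn
      rw [Finset.mem_Icc, hfloor]
      exact ⟨Nat.div_pos (Nat.le_of_dvd (by omega) hdvd) hμ0, Nat.div_le_div_right hn2⟩
    · intro h _; exact Nat.mul_div_cancel_left h hμ0
    · intro n hn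
      have hn' : n ∈ I.filter (fun n => μ ∣ n) := by simpa using hn
      exact Nat.mul_div_cancel' (Finset.mem_filter.mp hn').2
    · intro h _; rfl
  rw [Finset.sum_congr rfl h1]
  -- swap: `Σ_μ Σ_{n : μ ∣ n} = Σ_n #{μ ∈ I : μ ∣ n}`
  have h2 : ∑ μ ∈ I, ∑ n ∈ I.filter (fun n => μ ∣ n), ‖γ n‖ ^ 2 =
      ∑ n ∈ I, ((I.filter (fun μ => μ ∣ n)).card : ℝ) * ‖γ n‖ ^ 2 := by
    simp_rw [Finset.sum_filter]
    rw [Finset.sum_comm]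
    refine Finset.sum_congr rfl fun n _ => ?_
    rw [← Finset.sum_filter, Finset.sum_const, nsmul_eq_mul]
  rw [h2, Finset.mul_sum]
  refine Finset.sum_le_sum fun n hn => ?_
  by_cases hγ : γ n = 0
  · simp [hγ]
  · have hn0 : n ≠ 0 := by have := (Finset.mem_Icc.mp hn).1; omega
    have hcard : ((I.filter (fun μ => μ ∣ n)).card : ℝ) ≤ T :=
      le_trans (by exact_mod_cast kfo_card_filter_dvd_le I hn0) (hT n hγ)
    exact mul_le_mul_of_nonneg_right hcard (by positivity)

end Literature.NumberTheory.LFunctions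

end
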